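import Summits.BirchSwinnertonDyer.Rank1Residual.Additive.X3BranchLayerTClass
import Summits.BirchSwinnertonDyer.Rank1Residual.Additive.X3BranchKummerLayerTwistedArith
import HarnessLib

/-!
# X3, the DEGENERATE rows OFF the sub-locus: one T-side class over the first layer FROM INTEGER TABLES
# (cell `bsd-eis`, seat `bsd-eis-x3` gen 7; the `decide`-able front end of
# `KummerLayerTwisted.exists_layerTClass_mem_residualLineH1` through the `ℤ[ζ₉]` arithmetic of
# `X3BranchKummerLayerTwistedArith.lean` (MEMO-9 §2.4 (f)); route K1 `AdditiveBranchIMC`, crux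
# `GordTwoRankZeroOffCaseOne` — supports only)

HONEST FRAMING (`run/shared/lean/pub/bsd-eis/README.md` §4): THEOREMS ONLY (no `def`, no named fact,
no `sorry`); nothing is booked; no label, tier or count of record moves.

## What

A per-pair display holds, for each prime `λ_j ∣ ℓ ≡ 1 (mod 9)` of `ℚ_1`, integer sextuples
`b` (`= ϖ_j c(ϖ_j)²` on `1, ζ, …, ζ⁵`), `b'` (`= ℓ³/b`), `cb` (`= c(b)`), `t, t2, e3` (`= E(θ), E(θ)²,
E(θ)³`), a triple `E` (`= π_j` on `1, θ, θ²`) and `n = ℓ³`, with the identities `b·b' = n`,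
`cb = c(b)`, `t = E(θ)`, `t2 = t·t`, `e3 = t2·t`, `cb·b = e3` — all linear/bilinear INTEGER identities
checked by `decide` (data: `x3-g7-gen/tside-data-j276658.txt`).
* `aeval_sum6` / `aeval_sum3` — the polynomial `Σ C bᵢ X^i` evaluates to `Σ bᵢ x^i`;
* `exists_layerTClass_of_tables` — from these tables, a cube root `β` of `b(ζ)` and a class of
  `H¹(ℚ_Σ/ℚ_∞, Φ₀)` with the twisted Kummer character of `β` as cocycle (as in
  `exists_layerTClass_mem_residualLineH1`).
References: [GreenbergVatsal2000] §2 pp. 26–30; [SerreLocalFields1979] Ch. X §3; [Washington1997] §2.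
-/

set_option autoImplicit false

noncomputable section

open scoped Classical AddSubgroup

namespace Summit.BirchSwinnertonDyer.Rank1Residual.Additive

namespace KummerLayerTwisted

open Field Polynomial NumberField IsDedekindDomain WeierstrassCurve
  Literature.NumberTheory.GaloisRepresentations
  Literature.NumberTheory.EllipticCurves
  Literature.NumberTheory.EllipticCurves.GreenbergSelmer
  Literature.NumberTheory.EllipticCurves.GreenbergVatsal2000
  Literature.NumberTheory.EllipticCurves.Rank1Residual
  TrivialLineClasses

/-- **Evaluation of the sextuple polynomial** `Σ_{i<6} C bᵢ X^i` at `x`: `Σ bᵢ x^i`. [folklore] -/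
theorem aeval_sum6 {A : Type*} [CommRing A] (x : A) (b : Fin 6 → ℤ) :
    aeval x (C (b 0) + C (b 1) * X + C (b 2) * X ^ 2 + C (b 3) * X ^ 3 + C (b 4) * X ^ 4 +
        C (b 5) * X ^ 5) =
      (b 0 : A) + b 1 * x + b 2 * x ^ 2 + b 3 * x ^ 3 + b 4 * x ^ 4 + b 5 * x ^ 5 := by
  simp only [map_add, map_mul, map_pow, aeval_C, aeval_X]
  simp only [eq_intCast]

/-- **Evaluation of the triple polynomial** `Σ_{i<3} C eᵢ X^i` at `x`: `Σ eᵢ x^i`. [folklore] -/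
theorem aeval_sum3 {A : Type*} [CommRing A] (x : A) (e : Fin 3 → ℤ) :
    aeval x (C (e 0) + C (e 1) * X + C (e 2) * X ^ 2) = (e 0 : A) + e 1 * x + e 2 * x ^ 2 := by
  simp only [map_add, map_mul, map_pow, aeval_C, aeval_X]
  simp only [eq_intCast]

variable {W : WeierstrassCurve ℚ}

/-- **One T-side class over the first layer FROM INTEGER TABLES.** See the module docstring; the
integer hypotheses are the `decide`-able identities `b·b' = (n,0,0,0,0,0)`, `cb = c(b)`, `t = E(θ)`,
`t2 = t·t`, `e3 = t2·t`, `cb·b = e3` in `ℤ[ζ₉]` (`ev9_mul`, `ev9_pow_eight`, `ev9_theta`). Output as in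
`exists_layerTClass_mem_residualLineH1`, for some cube root `β` of `b(ζ) = Σ bᵢζ^i`, with
`e = E₀ + E₁θ + E₂θ²`, `θ = ζ + ζ⁸`. [cite: GreenbergVatsal2000, §2 pp. 28–30]
[cite: SerreLocalFields1979, Ch. X §3] -/
theorem exists_layerTClass_of_tables [hp : Fact (Nat.Prime 3)]
    (κ : ZpExtension ℚ 3) (hκ : κ.IsCyclotomic) (S₀ : Finset (HeightOneSpectrum (𝓞 ℚ)))
    {Φ₀ : AddSubgroup (W.geomTorsion ((3 : ℕ) : ℤ))} (hΦ : IsRationalLine W 3 Φ₀)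
    (htriv : ∀ (σ : absoluteGaloisGroup ℚ) (Pt : geomTorsion W ((3 : ℕ) : ℤ)), Pt ∈ Φ₀ → σ • Pt = Pt)
    (x₀ : (residualLine Φ₀ hΦ).Sub) (hx₀ : 3 • x₀ = 0)
    {ζ : AlgebraicClosure ℚ} (hζ : IsPrimitiveRoot ζ 9)
    (b b' cb t t2 e3 : Fin 6 → ℤ) (E : Fin 3 → ℤ) {n : ℕ} (hn0 : n ≠ 0)
    (hnS : ∀ v : HeightOneSpectrum (𝓞 ℚ), ((n : ℕ) : 𝓞 ℚ) ∈ v.asIdeal → v ∈ S₀)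
    (hN : (n : ℤ) = b 0 * b' 0 - (b 1 * b' 5 + b 2 * b' 4 + b 3 * b' 3 + b 4 * b' 2 + b 5 * b' 1) +
        (b 4 * b' 5 + b 5 * b' 4) ∧
      (0 : ℤ) = b 0 * b' 1 + b 1 * b' 0 - (b 2 * b' 5 + b 3 * b' 4 + b 4 * b' 3 + b 5 * b' 2) +
        b 5 * b' 5 ∧
      (0 : ℤ) = b 0 * b' 2 + b 1 * b' 1 + b 2 * b' 0 - (b 3 * b' 5 + b 4 * b' 4 + b 5 * b' 3) ∧
      (0 : ℤ) = b 0 * b' 3 + b 1 * b' 2 + b 2 * b' 1 + b 3 * b' 0 -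
        (b 1 * b' 5 + b 2 * b' 4 + b 3 * b' 3 + b 4 * b' 2 + b 5 * b' 1) ∧
      (0 : ℤ) = b 0 * b' 4 + b 1 * b' 3 + b 2 * b' 2 + b 3 * b' 1 + b 4 * b' 0 -
        (b 2 * b' 5 + b 3 * b' 4 + b 4 * b' 3 + b 5 * b' 2) ∧
      (0 : ℤ) = b 0 * b' 5 + b 1 * b' 4 + b 2 * b' 3 + b 3 * b' 2 + b 4 * b' 1 + b 5 * b' 0 -
        (b 3 * b' 5 + b 4 * b' 4 + b 5 * b' 3))
    (hcb : cb 0 = b 0 - b 3 ∧ cb 1 = -b 2 ∧ cb 2 = -b 1 ∧ cb 3 = -b 3 ∧ cb 4 = b 5 - b 2 ∧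
      cb 5 = b 4 - b 1)
    (ht : t 0 = E 0 + 2 * E 2 ∧ t 1 = E 1 - E 2 ∧ t 2 = E 2 - E 1 ∧ t 3 = 0 ∧ t 4 = -E 2 ∧
      t 5 = -E 1)
    (ht2 : t2 0 = t 0 * t 0 - (t 1 * t 5 + t 2 * t 4 + t 3 * t 3 + t 4 * t 2 + t 5 * t 1) +
        (t 4 * t 5 + t 5 * t 4) ∧
      t2 1 = t 0 * t 1 + t 1 * t 0 - (t 2 * t 5 + t 3 * t 4 + t 4 * t 3 + t 5 * t 2) + t 5 * t 5 ∧
      t2 2 = t 0 * t 2 + t 1 * t 1 + t 2 * t 0 - (t 3 * t 5 + t 4 * t 4 + t 5 * t 3) ∧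
      t2 3 = t 0 * t 3 + t 1 * t 2 + t 2 * t 1 + t 3 * t 0 -
        (t 1 * t 5 + t 2 * t 4 + t 3 * t 3 + t 4 * t 2 + t 5 * t 1) ∧
      t2 4 = t 0 * t 4 + t 1 * t 3 + t 2 * t 2 + t 3 * t 1 + t 4 * t 0 -
        (t 2 * t 5 + t 3 * t 4 + t 4 * t 3 + t 5 * t 2) ∧
      t2 5 = t 0 * t 5 + t 1 * t 4 + t 2 * t 3 + t 3 * t 2 + t 4 * t 1 + t 5 * t 0 -
        (t 3 * t 5 + t 4 * t 4 + t 5 * t 3))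
    (he3 : e3 0 = t2 0 * t 0 - (t2 1 * t 5 + t2 2 * t 4 + t2 3 * t 3 + t2 4 * t 2 + t2 5 * t 1) +
        (t2 4 * t 5 + t2 5 * t 4) ∧
      e3 1 = t2 0 * t 1 + t2 1 * t 0 - (t2 2 * t 5 + t2 3 * t 4 + t2 4 * t 3 + t2 5 * t 2) + t2 5 * t 5 ∧
      e3 2 = t2 0 * t 2 + t2 1 * t 1 + t2 2 * t 0 - (t2 3 * t 5 + t2 4 * t 4 + t2 5 * t 3) ∧
      e3 3 = t2 0 * t 3 + t2 1 * t 2 + t2 2 * t 1 + t2 3 * t 0 -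
        (t2 1 * t 5 + t2 2 * t 4 + t2 3 * t 3 + t2 4 * t 2 + t2 5 * t 1) ∧
      e3 4 = t2 0 * t 4 + t2 1 * t 3 + t2 2 * t 2 + t2 3 * t 1 + t2 4 * t 0 -
        (t2 2 * t 5 + t2 3 * t 4 + t2 4 * t 3 + t2 5 * t 2) ∧
      e3 5 = t2 0 * t 5 + t2 1 * t 4 + t2 2 * t 3 + t2 3 * t 2 + t2 4 * t 1 + t2 5 * t 0 -
        (t2 3 * t 5 + t2 4 * t 4 + t2 5 * t 3))
    (hflip : e3 0 = cb 0 * b 0 - (cb 1 * b 5 + cb 2 * b 4 + cb 3 * b 3 + cb 4 * b 2 + cb 5 * b 1) +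
        (cb 4 * b 5 + cb 5 * b 4) ∧
      e3 1 = cb 0 * b 1 + cb 1 * b 0 - (cb 2 * b 5 + cb 3 * b 4 + cb 4 * b 3 + cb 5 * b 2) + cb 5 * b 5 ∧
      e3 2 = cb 0 * b 2 + cb 1 * b 1 + cb 2 * b 0 - (cb 3 * b 5 + cb 4 * b 4 + cb 5 * b 3) ∧
      e3 3 = cb 0 * b 3 + cb 1 * b 2 + cb 2 * b 1 + cb 3 * b 0 -
        (cb 1 * b 5 + cb 2 * b 4 + cb 3 * b 3 + cb 4 * b 2 + cb 5 * b 1) ∧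
      e3 4 = cb 0 * b 4 + cb 1 * b 3 + cb 2 * b 2 + cb 3 * b 1 + cb 4 * b 0 -
        (cb 2 * b 5 + cb 3 * b 4 + cb 4 * b 3 + cb 5 * b 2) ∧
      e3 5 = cb 0 * b 5 + cb 1 * b 4 + cb 2 * b 3 + cb 3 * b 2 + cb 4 * b 1 + cb 5 * b 0 -
        (cb 3 * b 5 + cb 4 * b 4 + cb 5 * b 3)) :
    ∃ (χ : absoluteGaloisGroup ℚ → ZMod 3) (β : AlgebraicClosure ℚ)
      (c : subgroupH1 κ.kerSubgroup (residualLine Φ₀ hΦ).Sub),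
      β ^ 3 = (b 0 : AlgebraicClosure ℚ) + b 1 * ζ + b 2 * ζ ^ 2 + b 3 * ζ ^ 3 + b 4 * ζ ^ 4 +
        b 5 * ζ ^ 5 ∧
      c ∈ residualLineH1 W 3 κ S₀ Φ₀ hΦ ∧
      (∀ h : κ.kerSubgroup, (cocycleOf κ.kerSubgroup (residualLine Φ₀ hΦ).Sub
        (subgroup_smul_eq_self_of_trivial κ.kerSubgroup (residualLine_smul_eq_self hΦ htriv)) c).1 h =
        (χ h).val • x₀) ∧
      (∀ σ ∈ κ.layerSubgroup 1, ∀ τ ∈ κ.layerSubgroup 1, χ (σ * τ) = χ σ + χ τ) ∧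
      (∀ σ ∈ κ.layerSubgroup 1, σ • ζ ^ 3 = ζ ^ 3 →
        ∃ m : ℕ, σ • β = (ζ ^ 3) ^ m * β ∧ χ σ = m) ∧
      (∀ σ ∈ κ.layerSubgroup 1, σ • ζ ^ 3 ≠ ζ ^ 3 →
        ∃ m : ℕ, σ • β = (ζ ^ 3) ^ m *
          ((E 0 : AlgebraicClosure ℚ) + E 1 * (ζ + ζ ^ 8) + E 2 * (ζ + ζ ^ 8) ^ 2) * β⁻¹ ∧
          χ σ = -(m : ZMod 3)) := by
  have hrel : ζ ^ 6 + ζ ^ 3 + 1 = 0 := zeta9_rel hζ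
  have h9 : ζ ^ 9 = 1 := hζ.pow_eq_one
  -- the polynomials
  set B : ℤ[X] := C (b 0) + C (b 1) * X + C (b 2) * X ^ 2 + C (b 3) * X ^ 3 + C (b 4) * X ^ 4 +
    C (b 5) * X ^ 5 with hBdef
  set B' : ℤ[X] := C (b' 0) + C (b' 1) * X + C (b' 2) * X ^ 2 + C (b' 3) * X ^ 3 + C (b' 4) * X ^ 4 +
    C (b' 5) * X ^ 5 with hB'def
  set EP : ℤ[X] := C (E 0) + C (E 1) * X + C (E 2) * X ^ 2 with hEPdef
  have hB : aeval ζ B = (b 0 : AlgebraicClosure ℚ) + b 1 * ζ + b 2 * ζ ^ 2 + b 3 * ζ ^ 3 +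
      b 4 * ζ ^ 4 + b 5 * ζ ^ 5 := aeval_sum6 ζ b
  have hB8 : aeval (ζ ^ 8) B = (b 0 : AlgebraicClosure ℚ) + b 1 * ζ ^ 8 + b 2 * (ζ ^ 8) ^ 2 +
      b 3 * (ζ ^ 8) ^ 3 + b 4 * (ζ ^ 8) ^ 4 + b 5 * (ζ ^ 8) ^ 5 := aeval_sum6 (ζ ^ 8) b
  have hB' : aeval ζ B' = (b' 0 : AlgebraicClosure ℚ) + b' 1 * ζ + b' 2 * ζ ^ 2 + b' 3 * ζ ^ 3 +
      b' 4 * ζ ^ 4 + b' 5 * ζ ^ 5 := aeval_sum6 ζ b'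
  have hEP : aeval (ζ + ζ ^ 8) EP = (E 0 : AlgebraicClosure ℚ) + E 1 * (ζ + ζ ^ 8) +
      E 2 * (ζ + ζ ^ 8) ^ 2 := aeval_sum3 (ζ + ζ ^ 8) E
  -- `b·b' = n`
  obtain ⟨n0, n1, n2, n3, n4, n5⟩ := hN
  have hn : aeval ζ B * aeval ζ B' = (n : AlgebraicClosure ℚ) := by
    rw [hB, hB', ev9_mul hrel b b' (n : ℤ) 0 0 0 0 0 n0 n1 n2 n3 n4 n5]
    push_cast; ring
  -- `c(b)·b = E(θ)³`
  obtain ⟨c0, c1, c2, c3, c4, c5⟩ := hcb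
  obtain ⟨t0, t1, t2', t3, t4, t5⟩ := ht
  obtain ⟨s0, s1, s2, s3, s4, s5⟩ := ht2
  obtain ⟨u0, u1, u2, u3, u4, u5⟩ := he3
  obtain ⟨f0, f1, f2, f3, f4, f5⟩ := hflip
  have hcb' := ev9_pow_eight hrel h9 b (cb 0) (cb 1) (cb 2) (cb 3) (cb 4) (cb 5) c0 c1 c2 c3 c4 c5
  have ht' : (E 0 : AlgebraicClosure ℚ) + E 1 * (ζ + ζ ^ 8) + E 2 * (ζ + ζ ^ 8) ^ 2 =
      (t 0 : AlgebraicClosure ℚ) + t 1 * ζ + t 2 * ζ ^ 2 + t 3 * ζ ^ 3 + t 4 * ζ ^ 4 + t 5 * ζ ^ 5 := by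
    rw [ev9_theta hrel h9 E (t 0) (t 1) (t 2) (t 4) (t 5) t0 t1 t2' t4 t5, t3]
    push_cast; ring
  have ht2' := ev9_mul hrel t t (t2 0) (t2 1) (t2 2) (t2 3) (t2 4) (t2 5) s0 s1 s2 s3 s4 s5
  have he3' := ev9_mul hrel t2 t (e3 0) (e3 1) (e3 2) (e3 3) (e3 4) (e3 5) u0 u1 u2 u3 u4 u5
  have hflip' := ev9_mul hrel cb b (e3 0) (e3 1) (e3 2) (e3 3) (e3 4) (e3 5) f0 f1 f2 f3 f4 f5
  have hcube : ((t 0 : AlgebraicClosure ℚ) + t 1 * ζ + t 2 * ζ ^ 2 + t 3 * ζ ^ 3 + t 4 * ζ ^ 4 +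
      t 5 * ζ ^ 5) ^ 3 = (e3 0 : AlgebraicClosure ℚ) + e3 1 * ζ + e3 2 * ζ ^ 2 + e3 3 * ζ ^ 3 +
      e3 4 * ζ ^ 4 + e3 5 * ζ ^ 5 := by
    rw [← he3', ← ht2']; ring
  have hflipA : aeval (ζ ^ 8) B * aeval ζ B = aeval (ζ + ζ ^ 8) EP ^ 3 := by
    rw [hB8, hB, hEP, hcb', hflip', ht', hcube]
  -- a cube root and the class
  obtain ⟨β, hβ⟩ := IsAlgClosed.exists_pow_nat_eq (aeval ζ B) (by norm_num : 0 < 3)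
  obtain ⟨χ, c, hc, hcoc, hadd, h₁, h₂⟩ := exists_layerTClass_mem_residualLineH1 κ hκ S₀ hΦ htriv x₀ hx₀
    hζ B B' EP hn0 hn hnS hflipA hβ
  refine ⟨χ, β, c, by rw [hβ, hB], hc, hcoc, hadd, h₁, fun σ hσ h3 ↦ ?_⟩
  obtain ⟨m, hm, hχm⟩ := h₂ σ hσ h3
  exact ⟨m, by rw [hm, hEP], hχm⟩

end KummerLayerTwisted

end Summit.BirchSwinnertonDyer.Rank1Residual.Additive

end
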